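import Literature.NumberTheory.EllipticCurves.AnticyclotomicSignedTransferTheorem
import Literature.NumberTheory.EllipticCurves.AnticyclotomicSignedMainConjectureTransfer
import HarnessLib

/-!
# Stub S1 `stub_bdpLowerHalfRatSS` of line `bdpline` (crux `AnticyclotomicEisensteinDivisibility`,
# stmt-BirchSwinnertonDyer-20727) — the T68 side hypothesis `hinj` WITHOUT a Tamagawa binder:
# `loc_𝔭` is injective on `Sel_ε(K, 𝐓^ac)` modulo Castella–Wan 2024 Lemma 6.7 (typed, refereed) and
# the rank-one input `X_ε` of rank one that the transfer already carries

Width seat bsd-line-sbc-p1-w3 (gen 2), `--supports stmt-BirchSwinnertonDyer-20727`. Companion of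
`…CompactSignedRankOne` (p635497), which supplies the hypothesis `hinj` of the Eisenstein-direction
transfer `SignedBaseChangeAcDivEisensteinTransfer.TransferInputs.span_pow_mul_charIdeal_le_span_sq`
(p634573) modulo Hatley–Lei–Vigni 2022 Prop. 5.7 + Longo–Vigni 2019 Thm. 1.4, at the price of HLV's
binder (Tam) `p ∤ ∏ c_ℓ`. THIS FILE removes that binder: the typed refereed fact
`AcSigned.castellaWan2024_lemma67_finrank_torsionCharIdeal` (Castella–Wan, Math. Ann. 389 (2024),
Lemma 6.7; its FIRST conjunct is part (1) "the modules `X_±` and `Sel_±(K, 𝐓^ac)` have the same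
`Λ^ac`-rank", binders `Setting` + conductor + (Heeg) + `3 < p` only) turns the transfer's OWN input
`hX : X.HasRank … (sgn ε) 1` (on the refereed road: Longo–Vigni Thm. 1.4 transported by
`…XAcTorsionSignedRank`, p631478) into `finrank_Λ Sel_ε(K, 𝐓^ac) = 1`, and the printed argument
"Since `H¹(K, 𝐓^ac)` has trivial `Λ^ac`-torsion, the non-vanishing of `loc_𝔭` and the equality
`rank_{Λac}(Sel_±(K, 𝐓^ac)) = 1` implies that `Sel^{str,±}(K, 𝐓^ac) = 0`" (MS p. 30) runs from the
`finrank` alone — finite generation of `Sel_ε(K, 𝐓^ac)` is NOT needed (`Module.finrank = 1` forces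
`Module.rank = 1`), so the tree's `TransferInputs.locSignedAt_injective` (which asks
`selmerLambdaAdic.HasRank`, i.e. also `Module.Finite`) is re-run in that weaker currency.

## Contents (all PROVED, standard axioms; no definition, no new named fact, no `sorry`)

* `TransferInputs.locSignedAt_injective_of_finrank_eq_one` — generic (`W` over any number field `K`):
  `TransferInputs … ε z L` + `finrank_Λ Sel_ε(K, 𝐓^ac) = 1` ⟹ `loc_𝔭` injective on `Sel_ε(K, 𝐓^ac)`.
* `finrank_selmerLambdaAdic_sgn_eq_one_of_lemma67` — CW24 Lemma 6.7 (fact) + `X.HasRank … (sgn ε) 1`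
  ⟹ `finrank_Λ Sel_ε(K, 𝐓^ac) = 1` (base change `W⁄K`, `Setting`).
* `locSignedAt_injective_of_lemma67` — `hinj` of p634573 modulo {CW24 Lemma 6.7} given the transfer's
  own inputs `TransferInputs` and `hX`; NO Tamagawa binder.
Nothing about elliptic curves is asserted unconditionally: the fact is a hypothesis (`def … : Prop` of
the Literature layer). BSD / the crux / S1 are NOT proved by this file.

References: [CastellaWan2023] Lemma 6.7 (1) (MS p. 28), proof of Thm. 6.8 (MS p. 30) (= arXiv:1607.02019v3
Prop. 5.15, eq. (5.9)–(5.10)); [PerrinRiou1995Asterisque] §1.3.3 (torsion-freeness of `H¹(K, 𝐓^ac)`,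
through `TransferInputs.torsionFree`); [BourbakiAC5to7] Ch. VII §4 no. 1.
-/

-- D-0017: single-problem summit, the namespace repeats the problem name by design.
set_option linter.dupNamespace false
set_option autoImplicit false

noncomputable section

open scoped Classical

universe u

namespace Summit.BirchSwinnertonDyer.BirchSwinnertonDyer.Theorems.SignedBaseChangeAcDivTransferSideInjective

open NumberField IsDedekindDomain Field
open Literature.NumberTheory.EllipticCurves Literature.NumberTheory.GaloisRepresentations
open Literature.NumberTheory.EllipticCurves.AcSigned

/-! ## §1 `loc_𝔭` is injective on `Sel_ε(K, 𝐓^ac)` from `finrank = 1` alone (generic) -/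

section Generic

variable {K : Type u} [Field K] [NumberField K] {W : WeierstrassCurve K} {p : ℕ} [Fact p.Prime]
  {κ : ZpExtension K p} {γ : absoluteGaloisGroup K} {hγ : κ.IsTopGenerator γ}
  {𝔭 : HeightOneSpectrum (𝓞 K)} {h𝔭 : IsNonsplitIn κ 𝔭} {γ𝔭 : absoluteGaloisGroup (𝔭.adicCompletion K)}
  {hγ𝔭 : κ (resGalOfEmb (closureEmb (K := K) (𝔭.adicCompletion K)) γ𝔭) = κ γ}
  {𝔭' : HeightOneSpectrum (𝓞 K)} {h𝔭𝔭' : 𝔭 ≠ 𝔭'} {h𝔭p : ((p : ℕ) : 𝓞 K) ∈ 𝔭.asIdeal} {ε : ℤˣ}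
  {z : selmerLambdaAdic W p κ γ (fun _ ↦ .sgn ε)} {L : UnrSeries p}

/-- **"`Sel^{str,±}(K, 𝐓^ac) = 0`" from `finrank = 1` only: `loc_𝔭` is INJECTIVE on `Sel_ε(K, 𝐓^ac)`**
when `finrank_Λ Sel_ε(K, 𝐓^ac) = 1` (no finite-generation hypothesis: `Module.finrank = 1` already
gives `Module.rank = 1`). Printed: "Since `H¹(K, 𝐓^ac)` has trivial `Λ^ac`-torsion, the non-vanishing
of `loc_𝔭` and the equality `rank_{Λac}(Sel_±(K, 𝐓^ac)) = 1` implies that `Sel^{str,±}(K, 𝐓^ac) = 0`".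
Proof (the tree's `TransferInputs.locSignedAt_injective`, verbatim after the rank step): for `x` with
`loc_𝔭 x = 0`, rank one gives `a x = b z` with `a ≠ 0` (`Module.exists_smul_eq_smul_of_rank_le_one`), so
`b · loc_𝔭 z = 0`, `b = 0` (`loc_nonTorsion`), `a x = 0`, `x = 0` (`torsionFree`).
[cite: CastellaWan2023, proof of Thm. 6.8 (MS p. 30)] [cite: PerrinRiou1995Asterisque, §1.3.3] -/
theorem TransferInputs.locSignedAt_injective_of_finrank_eq_one
    (h : TransferInputs W p κ γ hγ 𝔭 h𝔭 γ𝔭 hγ𝔭 𝔭' h𝔭𝔭' h𝔭p ε z L)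
    (hrank : letI := selmerLambdaAdic.moduleOfGen W p κ γ hγ (fun _ ↦ PCond.sgn ε)
      Module.finrank (IwasawaAlgebra p) (selmerLambdaAdic W p κ γ (fun _ ↦ .sgn ε)) = 1) :
    Function.Injective (locSignedAt W p κ 𝔭 h𝔭 γ γ𝔭 hγ𝔭 (fun _ ↦ .sgn ε) ε rfl h𝔭p) := by
  letI := selmerLambdaAdic.moduleOfGen W p κ γ hγ (fun _ ↦ PCond.sgn ε)
  letI := localSignedLambdaAdic.moduleOfGen (W.baseChange (𝔭.adicCompletion K)) p (localizeAt κ 𝔭 h𝔭)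
    γ𝔭 (isTopGenerator_localize_of_apply_eq p κ _ h𝔭 hγ𝔭 hγ) ε
  haveI : Module.IsTorsionFree (IwasawaAlgebra p) (selmerLambdaAdic W p κ γ (fun _ ↦ .sgn ε)) :=
    Module.IsTorsionFree.of_smul_eq_zero (h.torsionFree (fun _ ↦ .sgn ε))
  have hrk : Module.rank (IwasawaAlgebra p) (selmerLambdaAdic W p κ γ (fun _ ↦ .sgn ε)) ≤ 1 := by
    have h1 : Module.rank (IwasawaAlgebra p) (selmerLambdaAdic W p κ γ (fun _ ↦ .sgn ε)) = (1 : ℕ) :=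
      (Cardinal.toNat_eq_iff one_ne_zero).1 hrank
    rw [h1, Nat.cast_one]
  rw [injective_iff_map_eq_zero]
  intro x hx
  obtain ⟨a, b, ha, hab⟩ := Module.exists_smul_eq_smul_of_rank_le_one hrk h.ne_zero x
  have hb : b = 0 := by
    refine h.loc_nonTorsion b ?_
    rw [← locSignedAt_smul W p κ 𝔭 h𝔭 hγ𝔭 hγ rfl h𝔭p b z, ← hab,
      locSignedAt_smul W p κ 𝔭 h𝔭 hγ𝔭 hγ rfl h𝔭p a x, hx, smul_zero]
  rw [hb, zero_smul] at hab
  exact ((h.torsionFree (fun _ ↦ .sgn ε) a x hab).resolve_left ha)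

end Generic

/-! ## §2 For a base change `W⁄K` in the `Setting`: `finrank Sel_ε = 1` and `hinj` modulo CW24 Lemma 6.7 -/

section Facts

variable {N : ℕ} {W : WeierstrassCurve ℚ} [W.IsGloballyMinimal] {K : Type} [Field K]
  [NumberField K] {p : ℕ} [Fact p.Prime] {κ : ZpExtension K p} {𝔭 𝔭' : HeightOneSpectrum (𝓞 K)}

/-- **`finrank_Λ Sel_ε(K, 𝐓^ac) = 1`, GRANTED Castella–Wan 2024 Lemma 6.7** (typed fact
`castellaWan2024_lemma67_finrank_torsionCharIdeal`, first conjunct = part (1): "`X_±` and `Sel_±(K, 𝐓^ac)`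
have the same `Λ^ac`-rank"), from the rank-one input `X.HasRank (W⁄K) p κ ∅ (sgn ε) hγ 1` (on the
refereed road: Longo–Vigni 2019 Thm. 1.4 through `…XAcTorsionSignedRank`). Binders = the fact's
(`Setting`, `N = N_E`, (Heeg), `3 < p`); NO Tamagawa binder.
[cite: CastellaWan2023, Lemma 6.7 (1) (MS p. 28)] [cite: LongoVigni2019, Thm. 1.4] -/
theorem finrank_selmerLambdaAdic_sgn_eq_one_of_lemma67
    (h67 : castellaWan2024_lemma67_finrank_torsionCharIdeal N W K p κ 𝔭 𝔭')
    (hS : Setting W K p κ 𝔭 𝔭') (hN : (W.conductorNorm ℤ : ℕ) = N) (hHg : SatisfiesHeegnerHypothesis N K)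
    (hp : 3 < p) {γ : absoluteGaloisGroup K} (hγ : κ.IsTopGenerator γ) (ε : ℤˣ)
    (hX : X.HasRank (W.baseChange K) p κ ∅ (fun _ ↦ .sgn ε) hγ 1) :
    letI := selmerLambdaAdic.moduleOfGen (W.baseChange K) p κ γ hγ (fun _ ↦ PCond.sgn ε)
    Module.finrank (IwasawaAlgebra p) (selmerLambdaAdic (W.baseChange K) p κ γ (fun _ ↦ .sgn ε)) = 1 := by
  obtain ⟨h1, -, -⟩ := h67 hS hN hHg hp γ hγ ε
  rw [h1]
  exact hX.2

/-- **`hinj` of the Eisenstein-direction transfer WITHOUT a Tamagawa binder: `loc_𝔭` is INJECTIVE on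
`Sel_ε(K, 𝐓^ac)`** ("`Sel^{str,±}(K, 𝐓^ac) = 0`") for every `TransferInputs` datum at `(𝔭, 𝔭')` of a base
change `W⁄K` in the `Setting`, GRANTED Castella–Wan 2024 Lemma 6.7 (typed), given the transfer's own
rank-one input `hX : X.HasRank … (sgn ε) 1`. Exactly the hypothesis `hinj` of
`SignedBaseChangeAcDivEisensteinTransfer.TransferInputs.span_pow_mul_charIdeal_le_span_sq` (p634573) —
so on the refereed road (`hX` from Longo–Vigni 2019 Thm. 1.4) `hinj` costs ONE MORE refereed fact of
the same paper whose `TransferInputs` the transfer already consumes, and no new binder.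
[cite: CastellaWan2023, Lemma 6.7 (1) (MS p. 28) and proof of Thm. 6.8 (MS p. 30)] -/
theorem locSignedAt_injective_of_lemma67
    (h67 : castellaWan2024_lemma67_finrank_torsionCharIdeal N W K p κ 𝔭 𝔭')
    (hS : Setting W K p κ 𝔭 𝔭') (hN : (W.conductorNorm ℤ : ℕ) = N) (hHg : SatisfiesHeegnerHypothesis N K)
    (hp : 3 < p) {γ : absoluteGaloisGroup K} {hγ : κ.IsTopGenerator γ} {h𝔭 : IsNonsplitIn κ 𝔭}
    {γ𝔭 : absoluteGaloisGroup (𝔭.adicCompletion K)}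
    {hγ𝔭 : κ (resGalOfEmb (closureEmb (K := K) (𝔭.adicCompletion K)) γ𝔭) = κ γ}
    {h𝔭𝔭' : 𝔭 ≠ 𝔭'} {h𝔭p : ((p : ℕ) : 𝓞 K) ∈ 𝔭.asIdeal} {ε : ℤˣ}
    {z : selmerLambdaAdic (W.baseChange K) p κ γ (fun _ ↦ .sgn ε)} {L : UnrSeries p}
    (hT : TransferInputs (W.baseChange K) p κ γ hγ 𝔭 h𝔭 γ𝔭 hγ𝔭 𝔭' h𝔭𝔭' h𝔭p ε z L)
    (hX : X.HasRank (W.baseChange K) p κ ∅ (fun _ ↦ .sgn ε) hγ 1) :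
    Function.Injective
      (locSignedAt (W.baseChange K) p κ 𝔭 h𝔭 γ γ𝔭 hγ𝔭 (fun _ ↦ .sgn ε) ε rfl h𝔭p) :=
  TransferInputs.locSignedAt_injective_of_finrank_eq_one hT
    (finrank_selmerLambdaAdic_sgn_eq_one_of_lemma67 h67 hS hN hHg hp hγ ε hX)

end Facts

end Summit.BirchSwinnertonDyer.BirchSwinnertonDyer.Theorems.SignedBaseChangeAcDivTransferSideInjective

end
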